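import Mathlib
import Summits.NavierStokesRegularity.NavierStokesRegularity.Theses.SubOnsagerCeiling
import Summits.NavierStokesRegularity.NavierStokesRegularity.Theorems.SubOnsagerCeilingKPUnitViscosity
import Summits.NavierStokesRegularity.NavierStokesRegularity.Theorems.SubOnsagerCeilingKPSmallDatumBarrier
import HarnessLib

/-!
# The crux `ForwardTailCeilingKP` is EXACTLY its large-data remainder at unit viscosity
# (helper file for stmt-NavierStokesRegularity-27057, `--supports`; hand leafhand-ns-subonsagerceiling-4 gen 25; def-free)

Composition, by name, of the two corners landed by this hand:

* `UnitViscosity.forwardTailCeilingKP_iff_unitViscosity` (p843933) — the `ν`-uniform crux (`∃ S θ C` before `∀ ν > 0`)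
  is equivalent to the same statement at `ν = 1` with the one-shell datum free (amplitude–time covariance);
* `SmallDatum.smallDatum_shellBarrier_of_inTableClass` (p843964) — below the dissipation threshold
  `512(1+ε₀)^{16}√(2E₀) < ν` every table of `E₂(R)` obeys the weighted shell barrier for every `θ ≤ 9`, `D = 4`, sign-free.

Hence **`forwardTailCeilingKP_iff_largeDataUnitViscosity`**: the crux is equivalent, BY NAME, to its restriction to unit
viscosity AND to one-shell data ABOVE the dissipation threshold, `512(1+ε₀)^{16}√(2E₀) ≥ 1`.  (`→` specialise; `←`: for a
table take the large-data witnesses `(S, θ, C)`, lower the exponent to `θ' = min θ 9 > 1/2`, and serve small data by the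
small-datum barrier summed over the forward sources and the shells, `C' = max C (16/(1 − (1+ε₀)^{-2θ'}))`.)
The auxiliary `tail_le_of_shellBarrier` is the geometric-series step «per-shell weighted barrier ⇒ weighted tail bound» on
a sub-family `S` of modes (the skeleton's `ceilingAt_of_shellBarrier`, Theorems-side and for partial mode sums).

READING (repair census of item 27057): what is open in the two registered stubs is precisely the behaviour of LARGE one-shell
data at FIXED viscosity (equivalently small viscosity at fixed datum) — the regime in which a cascade front forms; the
quantifier `∀ ν` and the small-data regime carry no content.  HONEST FRAMING: a by-name reduction between statements about
Tao-type MODEL lattice ODEs (route SubOnsagerCeiling, rung TL-M2Break); no stub, crux or summit is proved here and nothing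
in this file bears on Navier–Stokes regularity.
[cite: Tao2016AveragedNS, §4 Lemma 4.1 (4.5), (4.8), (4.13)] [cite: BarbatoMorandinRomito2011, §3.1 Prop. 3.3, §3.2]
-/

noncomputable section

-- the summit and its single sub-problem share the name (CONVENTIONS §1)
set_option linter.dupNamespace false

open Set

namespace Summit.NavierStokesRegularity.NavierStokesRegularity.Theorems.SubOnsagerCeiling.LargeData

open Literature.Analysis.FluidPDE Literature.Analysis.FluidPDE.TaoCascade
open Summit.NavierStokesRegularity.NavierStokesRegularity.Theses.SubOnsagerCeiling
open Summit.NavierStokesRegularity.NavierStokesRegularity.Theorems.SubOnsagerCeiling.UnitViscosity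
open Summit.NavierStokesRegularity.NavierStokesRegularity.Theorems.SubOnsagerCeiling.SmallDatum

/-! ## Per-shell weighted barrier ⇒ weighted tail bound on a sub-family of modes -/

/-- **Geometric series.** If at a time `t` every mode `i ∈ S` obeys `(1+ε₀)^{2θk}·½X_{i,k}(t)² ≤ D·E₀` at every shell
`k ≥ 0` (`ε₀, θ > 0`, `D, E₀ ≥ 0`), then `Σ_{k=n..N} Σ_{i∈S} ½X_{i,k}(t)² ≤ (4D/(1−(1+ε₀)^{-2θ}))·E₀·(1+ε₀)^{-2θn}`.
[cite: BarbatoMorandinRomito2011, §3.2 (shape of the barrier)] -/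
theorem tail_le_of_shellBarrier {ε₀ θ D E₀ t : ℝ} (hε : 0 < ε₀) (hθ : 0 < θ) (hD : 0 ≤ D) (hE : 0 ≤ E₀)
    (S : Finset (Fin 4)) {X : Fin 4 → ℤ → ℝ → ℝ}
    (h : ∀ i ∈ S, ∀ k : ℕ, (1 + ε₀) ^ (2 * θ * (k : ℝ)) * ((1 / 2 : ℝ) * X i (k : ℤ) t ^ 2) ≤ D * E₀)
    {n N : ℕ} (_hnN : n ≤ N) :
    ∑ k ∈ Finset.Icc n N, ∑ i ∈ S, (1 / 2 : ℝ) * X i (k : ℤ) t ^ 2 ≤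
      4 * D / (1 - (1 + ε₀) ^ (-(2 * θ))) * E₀ * (1 + ε₀) ^ (-(2 * θ * (n : ℝ))) := by
  have hb : (1 : ℝ) < 1 + ε₀ := by linarith
  have hb0 : (0 : ℝ) ≤ 1 + ε₀ := by linarith
  set r : ℝ := (1 + ε₀) ^ (-(2 * θ)) with hr_def
  have hr0 : 0 < r := Real.rpow_pos_of_pos (by linarith) _
  have hr1 : r < 1 := by
    have : (1 + ε₀) ^ (-(2 * θ)) < (1 + ε₀) ^ (0 : ℝ) :=
      Real.rpow_lt_rpow_of_exponent_lt hb (by linarith)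
    simpa [hr_def] using this
  have h1r : 0 < 1 - r := by linarith
  have hpow : ∀ k : ℕ, (1 + ε₀) ^ (2 * θ * (k : ℝ)) * r ^ k = 1 := by
    intro k
    rw [hr_def, ← Real.rpow_mul_natCast hb0, ← Real.rpow_add (by linarith)]
    have : 2 * θ * (k : ℝ) + -(2 * θ) * (k : ℝ) = 0 := by ring
    rw [this, Real.rpow_zero]
  have hshell : ∀ k : ℕ, ∑ i ∈ S, (1 / 2 : ℝ) * X i (k : ℤ) t ^ 2 ≤ 4 * D * E₀ * r ^ k := by
    intro k
    have hk : ∀ i ∈ S, (1 / 2 : ℝ) * X i (k : ℤ) t ^ 2 ≤ D * E₀ * r ^ k := by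
      intro i hi
      have Hi := h i hi k
      have hrk : 0 < r ^ k := pow_pos hr0 k
      have := mul_le_mul_of_nonneg_right Hi hrk.le
      calc (1 / 2 : ℝ) * X i (k : ℤ) t ^ 2
          = ((1 + ε₀) ^ (2 * θ * (k : ℝ)) * r ^ k) * ((1 / 2 : ℝ) * X i (k : ℤ) t ^ 2) := by rw [hpow k, one_mul]
        _ = (1 + ε₀) ^ (2 * θ * (k : ℝ)) * ((1 / 2 : ℝ) * X i (k : ℤ) t ^ 2) * r ^ k := by ring
        _ ≤ D * E₀ * r ^ k := this
    have hcard : (S.card : ℝ) ≤ 4 := by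
      have := S.card_le_univ; simp only [Fintype.card_fin] at this; exact_mod_cast this
    have hDE : 0 ≤ D * E₀ * r ^ k := by positivity
    calc ∑ i ∈ S, (1 / 2 : ℝ) * X i (k : ℤ) t ^ 2
        ≤ ∑ _i ∈ S, D * E₀ * r ^ k := Finset.sum_le_sum hk
      _ = (S.card : ℝ) * (D * E₀ * r ^ k) := by rw [Finset.sum_const, nsmul_eq_mul]
      _ ≤ 4 * (D * E₀ * r ^ k) := mul_le_mul_of_nonneg_right hcard hDE
      _ = 4 * D * E₀ * r ^ k := by ring
  have hgeom : ∑ k ∈ Finset.Icc n N, r ^ k ≤ r ^ n / (1 - r) := by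
    rw [← Finset.Ico_add_one_right_eq_Icc]
    exact geom_sum_Ico_le_of_lt_one hr0.le hr1
  have hrn : r ^ n = (1 + ε₀) ^ (-(2 * θ * (n : ℝ))) := by
    rw [hr_def, ← Real.rpow_mul_natCast hb0]
    congr 1; ring
  calc ∑ k ∈ Finset.Icc n N, ∑ i ∈ S, (1 / 2 : ℝ) * X i (k : ℤ) t ^ 2
      ≤ ∑ k ∈ Finset.Icc n N, 4 * D * E₀ * r ^ k := Finset.sum_le_sum fun k _ => hshell k
    _ = 4 * D * E₀ * ∑ k ∈ Finset.Icc n N, r ^ k := by rw [Finset.mul_sum (s := Finset.Icc n N)]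
    _ ≤ 4 * D * E₀ * (r ^ n / (1 - r)) :=
        mul_le_mul_of_nonneg_left hgeom (by positivity)
    _ = 4 * D / (1 - r) * E₀ * (1 + ε₀) ^ (-(2 * θ * (n : ℝ))) := by rw [← hrn]; field_simp

/-! ## The crux by name -/

/-- **THE CRUX IS ITS LARGE-DATA REMAINDER AT UNIT VISCOSITY.** `ForwardTailCeilingKP` (item 27057) is equivalent to the
same statement with `ν = 1` and the one-shell datum restricted to the large-data regime
`1 ≤ 512(1+ε₀)^{16}√(2E₀)`, `E₀ = Σ_j ½X₀_j²` (small data are served, sign-free and for every `θ ≤ 9`, by the tree's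
dissipation-threshold envelope; `∀ ν` is removed by amplitude–time covariance).
[cite: Tao2016AveragedNS, §4 Lemma 4.1 (4.5), (4.8), (4.13)] [cite: BarbatoMorandinRomito2011, §3.1 Prop. 3.3, §3.2] -/
theorem forwardTailCeilingKP_iff_largeDataUnitViscosity :
    ForwardTailCeilingKP ↔
    ∀ R : ℝ, 1 ≤ R → ∀ ε₀ : ℝ, 0 < ε₀ → ε₀ ≤ 1 → ∀ α : Fin 4 → Fin 4 → Fin 4 → ℤ × ℤ × ℤ → ℝ,
      InTableClass R α →
      (∀ (Y : Fin 4 → ℤ → ℝ → ℝ) (τ : ℝ), (∀ (j : Fin 4) (k : ℤ), 1 ≤ k → 0 ≤ Y j k τ) → ∀ δ : ℝ, 0 < δ →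
        ∀ (i : Fin 4) (n : ℤ), 1 ≤ n → Y i n τ = 0 → 0 ≤ quadTerm δ α Y i n τ) →
      (∀ a b i : Fin 4, a ≠ b → α a b i (0, 0, 1) = 0) →
      ∃ S : Finset (Fin 4), (∀ i, i ∉ S → ∀ j l : Fin 4, α i j l (0, 0, 1) = 0) ∧
      ∃ θ : ℝ, 1 / 2 < θ ∧ ∃ C : ℝ, 0 ≤ C ∧ ∀ (X₀ : Fin 4 → ℝ) (s : ℝ), 0 < s →
        1 ≤ 512 * (1 + ε₀) ^ (16 : ℝ) * Real.sqrt (2 * ∑ j : Fin 4, (1 / 2 : ℝ) * X₀ j ^ 2) →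
        ∀ X : Fin 4 → ℤ → ℝ → ℝ,
        (∀ (i : Fin 4) (k : ℤ), X i k 0 = if k = 0 then X₀ i else 0) →
        (∀ (i : Fin 4) (k : ℤ), k < 0 → ∀ t : ℝ, X i k t = 0) →
        (∃ M : ℝ, ∀ (t : ℝ) (i : Fin 4) (k : ℤ), (1 + (1 + ε₀) ^ ((10 : ℝ) * k)) * |X i k t| ≤ M) →
        (∀ (i : Fin 4) (k : ℤ), Continuous (X i k)) →
        (∀ (i : Fin 4) (k : ℤ), ∀ t ∈ Icc (0 : ℝ) s, HasDerivWithinAt (X i k)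
          (quadTerm ε₀ α X i k t - (1 + ε₀) ^ ((2 : ℝ) * k) * X i k t) (Icc (0 : ℝ) s) t) →
        (∀ t ∈ Icc (0 : ℝ) s, ∀ (i : Fin 4) (k : ℤ), 1 ≤ k → 0 ≤ X i k t) →
        ∀ n N : ℕ, n ≤ N → ∀ t ∈ Icc (0 : ℝ) s,
          ∑ k ∈ Finset.Icc n N, ∑ i ∈ S, (1 / 2 : ℝ) * X i (k : ℤ) t ^ 2 ≤
            C * (∑ i : Fin 4, (1 / 2 : ℝ) * X₀ i ^ 2) * (1 + ε₀) ^ (-(2 * θ * (n : ℝ))) := by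
  rw [forwardTailCeilingKP_iff_unitViscosity]
  constructor
  · intro h R hR ε₀ h0 h1 α hT hO hD
    obtain ⟨S, hS, θ, hθ, C, hC, H⟩ := h R hR ε₀ h0 h1 α hT hO hD
    exact ⟨S, hS, θ, hθ, C, hC, fun X₀ s hs _ => H X₀ s hs⟩
  · intro h R hR ε₀ h0 h1 α hT hO hD
    obtain ⟨S, hS, θ, hθ, C, hC, H⟩ := h R hR ε₀ h0 h1 α hT hO hD
    have hb : (1 : ℝ) < 1 + ε₀ := by linarith
    have hb1 : (1 : ℝ) ≤ 1 + ε₀ := hb.le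
    -- lowered exponent and enlarged constant
    set θ' : ℝ := min θ 9 with hθ'
    have hθ'pos : 1 / 2 < θ' := lt_min hθ (by norm_num)
    have hθ'le : θ' ≤ θ := min_le_left _ _
    have hθ'9 : θ' ≤ 9 := min_le_right _ _
    set r : ℝ := (1 + ε₀) ^ (-(2 * θ')) with hr_def
    have hr1 : r < 1 := by
      have : (1 + ε₀) ^ (-(2 * θ')) < (1 + ε₀) ^ (0 : ℝ) :=
        Real.rpow_lt_rpow_of_exponent_lt hb (by linarith)
      simpa [hr_def] using this
    have h1r : 0 < 1 - r := by linarith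
    set C' : ℝ := max C (4 * 4 / (1 - r)) with hC'
    have hCC' : C ≤ C' := le_max_left _ _
    have hC'0 : 0 ≤ C' := hC.trans hCC'
    refine ⟨S, hS, θ', hθ'pos, C', hC'0, fun X₀ s hs X hX0 hXneg hM hXc hXd hXpos n N hnN t ht => ?_⟩
    set E₀ : ℝ := ∑ j : Fin 4, (1 / 2 : ℝ) * X₀ j ^ 2 with hE₀
    have hE₀0 : 0 ≤ E₀ := Finset.sum_nonneg fun j _ => by positivity
    have hwn : 0 ≤ (1 + ε₀) ^ (-(2 * θ' * (n : ℝ))) := Real.rpow_nonneg (by linarith) _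
    by_cases hbig : 1 ≤ 512 * (1 + ε₀) ^ (16 : ℝ) * Real.sqrt (2 * E₀)
    · -- large data: the hypothesis, with the exponent lowered and the constant enlarged
      have key := H X₀ s hs hbig X hX0 hXneg hM hXc hXd hXpos n N hnN t ht
      have hmono : (1 + ε₀) ^ (-(2 * θ * (n : ℝ))) ≤ (1 + ε₀) ^ (-(2 * θ' * (n : ℝ))) :=
        Real.rpow_le_rpow_of_exponent_le hb1 (by
          have : (0 : ℝ) ≤ (n : ℝ) := Nat.cast_nonneg n
          nlinarith)
      calc ∑ k ∈ Finset.Icc n N, ∑ i ∈ S, (1 / 2 : ℝ) * X i (k : ℤ) t ^ 2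
          ≤ C * E₀ * (1 + ε₀) ^ (-(2 * θ * (n : ℝ))) := key
        _ ≤ C * E₀ * (1 + ε₀) ^ (-(2 * θ' * (n : ℝ))) := mul_le_mul_of_nonneg_left hmono (by positivity)
        _ ≤ C' * E₀ * (1 + ε₀) ^ (-(2 * θ' * (n : ℝ))) :=
            mul_le_mul_of_nonneg_right (mul_le_mul_of_nonneg_right hCC' hE₀0) hwn
    · -- small data: the dissipation-threshold barrier at `ν = 1`, summed over `S` and the shells
      have hsmall : 512 * (1 + ε₀) ^ (16 : ℝ) * Real.sqrt (2 * E₀) < 1 := lt_of_not_ge hbig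
      have hXd1 : ∀ (i : Fin 4) (k : ℤ), ∀ t ∈ Icc (0 : ℝ) s, HasDerivWithinAt (X i k)
          (quadTerm ε₀ α X i k t - 1 * (1 + ε₀) ^ ((2 : ℝ) * k) * X i k t) (Icc (0 : ℝ) s) t :=
        fun i k t ht => by rw [one_mul]; exact hXd i k t ht
      have hbar := smallDatum_shellBarrier_of_inTableClass (θ := θ') h0 one_pos hθ'9 hT hsmall hs.le
        hX0 hXneg hM hXc hXd1 t ht
      have htail := tail_le_of_shellBarrier (D := 4) (E₀ := E₀) h0 (by linarith) (by norm_num) hE₀0 S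
        (X := X) (fun i _ k => hbar i k) hnN
      calc ∑ k ∈ Finset.Icc n N, ∑ i ∈ S, (1 / 2 : ℝ) * X i (k : ℤ) t ^ 2
          ≤ 4 * 4 / (1 - r) * E₀ * (1 + ε₀) ^ (-(2 * θ' * (n : ℝ))) := htail
        _ ≤ C' * E₀ * (1 + ε₀) ^ (-(2 * θ' * (n : ℝ))) :=
            mul_le_mul_of_nonneg_right (mul_le_mul_of_nonneg_right (le_max_right _ _) hE₀0) hwn

end Summit.NavierStokesRegularity.NavierStokesRegularity.Theorems.SubOnsagerCeiling.LargeData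

end

/-! ## Appendix (same hand): the per-table SHELL BARRIER is its large-data remainder at unit viscosity

The chain-corner currency of every landed rung, `ShellBarrierAt R ε₀ α` (`Theorems/SubOnsagerCeilingDefs.lean`; by
`Theorems/SubOnsagerCeilingKPBarrierCurrency.lean` it is also the primary barrier of the registered stubs with the trivial
grading), reduces the same way: `∀ ν` is removed by `UnitViscosity.shellBarrierAt_iff_unitViscosity` and small data are served
by `SmallDatum.smallDatum_shellBarrier_of_inTableClass` (exponent lowered to `min θ 9`, constant enlarged to `max D 4`). -/

noncomputable section

-- the summit and its single sub-problem share the name (CONVENTIONS §1)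
set_option linter.dupNamespace false

namespace Summit.NavierStokesRegularity.NavierStokesRegularity.Theorems.SubOnsagerCeiling.LargeData

open Set
open Literature.Analysis.FluidPDE Literature.Analysis.FluidPDE.TaoCascade
open Summit.NavierStokesRegularity.NavierStokesRegularity.Theorems.SubOnsagerCeiling.UnitViscosity
open Summit.NavierStokesRegularity.NavierStokesRegularity.Theorems.SubOnsagerCeiling.SmallDatum

/-- **THE SHELL BARRIER IS ITS LARGE-DATA REMAINDER AT UNIT VISCOSITY.** For `ε₀ > 0`, `ShellBarrierAt R ε₀ α`
(`θ > 1/2`, `D` before `∀ ν > 0`; all modes, all shells) is equivalent to the same statement with `ν = 1` and the one-shell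
datum restricted to the large-data regime `1 ≤ 512(1+ε₀)^{16}√(2E₀)`.
[cite: Tao2016AveragedNS, §4 Lemma 4.1 (4.5), (4.8), (4.13)] [cite: BarbatoMorandinRomito2011, §3.1 Prop. 3.3, §3.2] -/
theorem shellBarrierAt_iff_largeDataUnitViscosity {R ε₀ : ℝ} (hε : 0 < ε₀)
    {α : Fin 4 → Fin 4 → Fin 4 → ℤ × ℤ × ℤ → ℝ} :
    ShellBarrierAt R ε₀ α ↔
    (InTableClass R α →
      (∀ (Y : Fin 4 → ℤ → ℝ → ℝ) (τ : ℝ), (∀ (j : Fin 4) (k : ℤ), 1 ≤ k → 0 ≤ Y j k τ) → ∀ δ : ℝ, 0 < δ →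
        ∀ (i : Fin 4) (n : ℤ), 1 ≤ n → Y i n τ = 0 → 0 ≤ quadTerm δ α Y i n τ) →
      ∃ θ : ℝ, 1 / 2 < θ ∧ ∃ D : ℝ, 0 ≤ D ∧ ∀ (X₀ : Fin 4 → ℝ) (s : ℝ), 0 < s →
        1 ≤ 512 * (1 + ε₀) ^ (16 : ℝ) * Real.sqrt (2 * ∑ j : Fin 4, (1 / 2 : ℝ) * X₀ j ^ 2) →
        ∀ X : Fin 4 → ℤ → ℝ → ℝ,
        (∀ (i : Fin 4) (k : ℤ), X i k 0 = if k = 0 then X₀ i else 0) →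
        (∀ (i : Fin 4) (k : ℤ), k < 0 → ∀ t : ℝ, X i k t = 0) →
        (∃ M : ℝ, ∀ (t : ℝ) (i : Fin 4) (k : ℤ), (1 + (1 + ε₀) ^ ((10 : ℝ) * k)) * |X i k t| ≤ M) →
        (∀ (i : Fin 4) (k : ℤ), Continuous (X i k)) →
        (∀ (i : Fin 4) (k : ℤ), ∀ t ∈ Icc (0 : ℝ) s, HasDerivWithinAt (X i k)
          (quadTerm ε₀ α X i k t - (1 + ε₀) ^ ((2 : ℝ) * k) * X i k t) (Icc (0 : ℝ) s) t) →
        (∀ t ∈ Icc (0 : ℝ) s, ∀ (i : Fin 4) (k : ℤ), 1 ≤ k → 0 ≤ X i k t) →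
        ∀ t ∈ Icc (0 : ℝ) s, ∀ (i : Fin 4) (k : ℕ),
          (1 + ε₀) ^ (2 * θ * (k : ℝ)) * ((1 / 2 : ℝ) * X i (k : ℤ) t ^ 2) ≤ D * (∑ j : Fin 4, (1 / 2 : ℝ) * X₀ j ^ 2)) := by
  rw [shellBarrierAt_iff_unitViscosity]
  constructor
  · intro h hT hO
    obtain ⟨θ, hθ, D, hD, H⟩ := h hT hO
    exact ⟨θ, hθ, D, hD, fun X₀ s hs _ => H X₀ s hs⟩
  · intro h hT hO
    obtain ⟨θ, hθ, D, hD, H⟩ := h hT hO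
    have hb1 : (1 : ℝ) ≤ 1 + ε₀ := by linarith
    set θ' : ℝ := min θ 9 with hθ'
    have hθ'pos : 1 / 2 < θ' := lt_min hθ (by norm_num)
    have hθ'le : θ' ≤ θ := min_le_left _ _
    have hθ'9 : θ' ≤ 9 := min_le_right _ _
    set D' : ℝ := max D 4 with hD'
    have hDD' : D ≤ D' := le_max_left _ _
    have hD'0 : 0 ≤ D' := hD.trans hDD'
    refine ⟨θ', hθ'pos, D', hD'0, fun X₀ s hs X hX0 hXneg hM hXc hXd hXpos t ht i k => ?_⟩
    set E₀ : ℝ := ∑ j : Fin 4, (1 / 2 : ℝ) * X₀ j ^ 2 with hE₀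
    have hE₀0 : 0 ≤ E₀ := Finset.sum_nonneg fun j _ => by positivity
    have hsq0 : 0 ≤ (1 / 2 : ℝ) * X i (k : ℤ) t ^ 2 := by positivity
    by_cases hbig : 1 ≤ 512 * (1 + ε₀) ^ (16 : ℝ) * Real.sqrt (2 * E₀)
    · -- large data: lower the exponent, enlarge the constant
      have key := H X₀ s hs hbig X hX0 hXneg hM hXc hXd hXpos t ht i k
      have hmono : (1 + ε₀) ^ (2 * θ' * (k : ℝ)) ≤ (1 + ε₀) ^ (2 * θ * (k : ℝ)) :=
        Real.rpow_le_rpow_of_exponent_le hb1 (by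
          have : (0 : ℝ) ≤ (k : ℝ) := Nat.cast_nonneg k
          nlinarith)
      calc (1 + ε₀) ^ (2 * θ' * (k : ℝ)) * ((1 / 2 : ℝ) * X i (k : ℤ) t ^ 2)
          ≤ (1 + ε₀) ^ (2 * θ * (k : ℝ)) * ((1 / 2 : ℝ) * X i (k : ℤ) t ^ 2) :=
            mul_le_mul_of_nonneg_right hmono hsq0
        _ ≤ D * E₀ := key
        _ ≤ D' * E₀ := mul_le_mul_of_nonneg_right hDD' hE₀0
    · -- small data: the dissipation-threshold barrier at `ν = 1`
      have hsmall : 512 * (1 + ε₀) ^ (16 : ℝ) * Real.sqrt (2 * E₀) < 1 := lt_of_not_ge hbig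
      have hXd1 : ∀ (i : Fin 4) (k : ℤ), ∀ t ∈ Icc (0 : ℝ) s, HasDerivWithinAt (X i k)
          (quadTerm ε₀ α X i k t - 1 * (1 + ε₀) ^ ((2 : ℝ) * k) * X i k t) (Icc (0 : ℝ) s) t :=
        fun i k t ht => by rw [one_mul]; exact hXd i k t ht
      have hbar := smallDatum_shellBarrier_of_inTableClass (θ := θ') hε one_pos hθ'9 hT hsmall hs.le
        hX0 hXneg hM hXc hXd1 t ht i k
      calc (1 + ε₀) ^ (2 * θ' * (k : ℝ)) * ((1 / 2 : ℝ) * X i (k : ℤ) t ^ 2) ≤ 4 * E₀ := hbar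
        _ ≤ D' * E₀ := mul_le_mul_of_nonneg_right (le_max_right _ _) hE₀0

end Summit.NavierStokesRegularity.NavierStokesRegularity.Theorems.SubOnsagerCeiling.LargeData

end
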